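import Summits.ResolutionOfSingularities.ResolutionOfSingularities.Theorems.FrobeniusLadderFInjectiveMacaulayficationFlatIntegralCM
import Summits.ResolutionOfSingularities.ResolutionOfSingularities.Theorems.FrobeniusLadderFInjectiveMacaulayficationTauFloorF5YChartAlgebra
import Mathlib.RingTheory.AdjoinRoot
import Mathlib.RingTheory.Ideal.KrullsHeightTheorem
import Mathlib.RingTheory.Ideal.Height
import HarnessLib

/-!
# (N2-X) The Rees chart `D(x̄)` of `Bl_τ(P2d4B)` as an ITERATED MONIC EXTENSION `T₂` of `k[x, y′, u′, w]`: tower algebra, universal property, the kill map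
# `κ` (`x, w, t̄, z̄′ ↦ 0`), `height (x, w) = 2` in `k[x, y′, u′, w]`, `x̄` a non-zero-divisor, and the CM clause at EVERY prime of `T₂`
# (crux `FInjectiveMacaulayfication` stmt-ResolutionOfSingularities-15315, chain w45a; res-L1-w45a-plan-1 g19 RULING R19.6 (3) «(N2) ROW #3 INPUT LEGALITY →
# stub-2; start with (N2)(E) `tauFloor_P2d4B_not_full`»; template = res-L1-w45a-stub-3 g10's (N1)(Y-a) `…TauFloorF5YChartAlgebra` (p631794); seat res-L1-w45a-stub-2 g8)

[OURS · L1 W4.5a] Support file (`--supports stmt-ResolutionOfSingularities-15315 --as helper`); replaces the role of NO printed item; NOT a statement of any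
manuscript; def-free (the tower polynomials are hypotheses `h₁ h₂` with their defining equations, the kill map is a hypothesis `κ` with its three defining values);
UNCONDITIONAL; characteristic-free (any field `k`). AI-written (AI review is weaker than expert review).

SETTING. `A₀ = k[X0..X4]/(f)`, `f = X4² + X0²X4 + X1³ + X2³ + X3⁵` (P2d4B: `x,y,u,t,z = X0..X4`, row #3 p630677), `τ = (x̄, ȳ, ū, t̄², z̄)`. The chart `D(x̄)` of
`Bl_τ X` has ring `A₀[y/x, u/x, t²/x, z/x]`: with `y = xy′`, `u = xu′`, `z = xz′`, `t² = xw`, `f = x²·(z′² + xz′ + x(y′³+u′³) + tw²)`. We type it as the TOWER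
`T₂ = B₀[t][z′]`, `B₀ = MvPolynomial (Fin 4) k` (`X 0 = x`, `X 1 = y′`, `X 2 = u′`, `X 3 = w`), `T₁ = AdjoinRoot h₁`, `h₁ = T² − xw`, `T₂ = AdjoinRoot h₂`,
`h₂ = Z² + (x·Z + (x(y′³+u′³) + t·w²))` — both MONIC, so `T₂` is FREE and FINITE over `B₀` (what res-L1-w45a-stub-3's engine `FlatIntegralCM` p629082 consumes).
* §1 monicity, `free_finite_tower`, relations `t_sq_eq : t̄² = x̄w̄`, `z_sq_eq : z̄′² = −(x̄z̄′ + x̄(ȳ′³+ū′³) + t̄w̄²)`, normal form `exists_nf_of_monic_two`,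
  ★ `algebraMap_X0_mem_nonZeroDivisors` (`x̄` is a non-zero-divisor: flatness over the domain `B₀`);
* §2 ★ `exists_towerLift` (UNIVERSAL PROPERTY: `g : B₀ → S`, `t₀² = g(x)g(w)`, `z₀² + g(x)z₀ + (g(x)(g(y′)³+g(u′)³) + t₀g(w)²) = 0` extend to `T₂ → S`),
  `tower₂_ringHom_ext`, `ker_killXW_eq : ker (x, w ↦ 0) = (x, w)` on `B₀`, ★ `height_span_X0_X3 : height (x, w) = 2`, `exists_killMap` (`κ : T₂ → B₀`, `x, w, t̄, z̄′ ↦ 0`);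
* ★ `cmCl_localization` / `cmCl_stalk` — the CM clause at EVERY prime / point of `T₂` (ONE `exact` over `FlatIntegralCM.cmCl_localization_of_isRegularRing`).
Sequel `…TauFloorBXChartNotFull`: `ker κ = (x̄, t̄, w̄, z̄′) =: 𝔮`, `height 𝔮 = 2` (incomparability + going-down over `𝔮 ∩ B₀ = (x, w)`), `dim (T₂)_𝔮 = 2`, and the
F-clause FAILS at `𝔮` for the parameter ideal `(x̄, w̄)` (`(t̄z̄′)² ∈ (x̄², w̄²)`, `t̄z̄′ ∉ (x̄, w̄)`); the chart identification `T₂ ≃+* blowupAlgebra τ x̄` and the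
other charts are further (N2) files. [cite: GortzWedhorn2020, (13.19) p. 415] [cite: Matsumura1987, Thm. 9.3, Thm. 9.5, Thm. 13.5]
-/

-- single-problem summit: the doubled namespace component is forced
set_option linter.dupNamespace false

noncomputable section

namespace Summit.ResolutionOfSingularities.ResolutionOfSingularities.Theorems.FInjectiveMacaulayfication.TauFloorBXChartAlgebra

open MvPolynomial IsLocalization
open Summit.ResolutionOfSingularities.ResolutionOfSingularities.Theorems.FInjectiveMacaulayfication
open SliceableCentre

variable (k : Type) [Field k]

/-! ## §1 The tower `T₂ = k[x, y′, u′, w][t][z′]` -/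

/-- `h₁ = T² − xw` is monic. [plumbing] -/
theorem monic_h₁ (h₁ : Polynomial (MvPolynomial (Fin 4) k)) (hh₁ : h₁ = Polynomial.X ^ 2 - Polynomial.C (X 0 * X 3)) : h₁.Monic := by
  rw [hh₁]; exact Polynomial.monic_X_pow_sub_C _ two_ne_zero

/-- `h₂ = Z² + x·Z + (x(y′³+u′³) + t·w²)` is monic. [plumbing] -/
theorem monic_h₂ (h₁ : Polynomial (MvPolynomial (Fin 4) k)) (h₂ : Polynomial (AdjoinRoot h₁))
    (hh₂ : h₂ = Polynomial.X ^ 2 + (Polynomial.C (algebraMap (MvPolynomial (Fin 4) k) (AdjoinRoot h₁) (X 0)) * Polynomial.X +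
      Polynomial.C (algebraMap (MvPolynomial (Fin 4) k) (AdjoinRoot h₁) (X 0 * (X 1 ^ 3 + X 2 ^ 3)) +
        AdjoinRoot.root h₁ * algebraMap (MvPolynomial (Fin 4) k) (AdjoinRoot h₁) (X 3 ^ 2)))) : h₂.Monic := by
  rw [hh₂]
  nontriviality (AdjoinRoot h₁)
  refine Polynomial.monic_X_pow_add ?_
  refine (Polynomial.degree_add_le _ _).trans_lt ?_
  refine max_lt ((Polynomial.degree_C_mul_X_le _).trans_lt (by exact_mod_cast Nat.lt_succ_self 1)) ?_
  exact (Polynomial.degree_C_le).trans_lt (by exact_mod_cast Nat.succ_pos 1)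

/-- `T₁` is free and finite over `B₀`. [Mathlib `AdjoinRoot.powerBasis'`] -/
theorem free_finite₁ (h₁ : Polynomial (MvPolynomial (Fin 4) k)) (hh₁ : h₁ = Polynomial.X ^ 2 - Polynomial.C (X 0 * X 3)) :
    Module.Free (MvPolynomial (Fin 4) k) (AdjoinRoot h₁) ∧ Module.Finite (MvPolynomial (Fin 4) k) (AdjoinRoot h₁) :=
  ⟨Module.Free.of_basis (AdjoinRoot.powerBasis' (monic_h₁ k h₁ hh₁)).basis, (AdjoinRoot.powerBasis' (monic_h₁ k h₁ hh₁)).finite⟩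

/-- `T₂` is free and finite over `T₁`. [Mathlib `AdjoinRoot.powerBasis'`] -/
theorem free_finite₂ (h₁ : Polynomial (MvPolynomial (Fin 4) k)) (h₂ : Polynomial (AdjoinRoot h₁))
    (hh₂ : h₂ = Polynomial.X ^ 2 + (Polynomial.C (algebraMap (MvPolynomial (Fin 4) k) (AdjoinRoot h₁) (X 0)) * Polynomial.X +
      Polynomial.C (algebraMap (MvPolynomial (Fin 4) k) (AdjoinRoot h₁) (X 0 * (X 1 ^ 3 + X 2 ^ 3)) +
        AdjoinRoot.root h₁ * algebraMap (MvPolynomial (Fin 4) k) (AdjoinRoot h₁) (X 3 ^ 2)))) :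
    Module.Free (AdjoinRoot h₁) (AdjoinRoot h₂) ∧ Module.Finite (AdjoinRoot h₁) (AdjoinRoot h₂) :=
  ⟨Module.Free.of_basis (AdjoinRoot.powerBasis' (monic_h₂ k h₁ h₂ hh₂)).basis, (AdjoinRoot.powerBasis' (monic_h₂ k h₁ h₂ hh₂)).finite⟩

/-- ★ **`T₂` is FREE and FINITE over `B₀ = k[x,y′,u′,w]`** (monic tower). [folklore] -/
theorem free_finite_tower (h₁ : Polynomial (MvPolynomial (Fin 4) k)) (hh₁ : h₁ = Polynomial.X ^ 2 - Polynomial.C (X 0 * X 3))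
    (h₂ : Polynomial (AdjoinRoot h₁))
    (hh₂ : h₂ = Polynomial.X ^ 2 + (Polynomial.C (algebraMap (MvPolynomial (Fin 4) k) (AdjoinRoot h₁) (X 0)) * Polynomial.X +
      Polynomial.C (algebraMap (MvPolynomial (Fin 4) k) (AdjoinRoot h₁) (X 0 * (X 1 ^ 3 + X 2 ^ 3)) +
        AdjoinRoot.root h₁ * algebraMap (MvPolynomial (Fin 4) k) (AdjoinRoot h₁) (X 3 ^ 2)))) :
    Module.Free (MvPolynomial (Fin 4) k) (AdjoinRoot h₂) ∧ Module.Finite (MvPolynomial (Fin 4) k) (AdjoinRoot h₂) := by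
  obtain ⟨hf₁, hfi₁⟩ := free_finite₁ k h₁ hh₁
  obtain ⟨hf₂, hfi₂⟩ := free_finite₂ k h₁ h₂ hh₂
  exact ⟨Module.Free.trans (S := AdjoinRoot h₁), Module.Finite.trans (AdjoinRoot h₁) (AdjoinRoot h₂)⟩

/-- The relation `t² = xw` in `T₁`. [plumbing] -/
theorem root₁_sq (h₁ : Polynomial (MvPolynomial (Fin 4) k)) (hh₁ : h₁ = Polynomial.X ^ 2 - Polynomial.C (X 0 * X 3)) :
    AdjoinRoot.root h₁ ^ 2 = AdjoinRoot.of h₁ (X 0 * X 3) := by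
  subst hh₁
  have h := AdjoinRoot.eval₂_root (Polynomial.X ^ 2 - Polynomial.C (X 0 * X 3 : MvPolynomial (Fin 4) k))
  rw [Polynomial.eval₂_sub, Polynomial.eval₂_X_pow, Polynomial.eval₂_C, sub_eq_zero] at h
  exact h

/-- The relation `z′² + x z′ + (x(y′³+u′³) + t w²) = 0` in `T₂`. [plumbing] -/
theorem root₂_rel (h₁ : Polynomial (MvPolynomial (Fin 4) k)) (h₂ : Polynomial (AdjoinRoot h₁))
    (hh₂ : h₂ = Polynomial.X ^ 2 + (Polynomial.C (algebraMap (MvPolynomial (Fin 4) k) (AdjoinRoot h₁) (X 0)) * Polynomial.X +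
      Polynomial.C (algebraMap (MvPolynomial (Fin 4) k) (AdjoinRoot h₁) (X 0 * (X 1 ^ 3 + X 2 ^ 3)) +
        AdjoinRoot.root h₁ * algebraMap (MvPolynomial (Fin 4) k) (AdjoinRoot h₁) (X 3 ^ 2)))) :
    AdjoinRoot.root h₂ ^ 2 + AdjoinRoot.of h₂ (algebraMap (MvPolynomial (Fin 4) k) (AdjoinRoot h₁) (X 0)) * AdjoinRoot.root h₂ +
      AdjoinRoot.of h₂ (algebraMap (MvPolynomial (Fin 4) k) (AdjoinRoot h₁) (X 0 * (X 1 ^ 3 + X 2 ^ 3)) +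
        AdjoinRoot.root h₁ * algebraMap (MvPolynomial (Fin 4) k) (AdjoinRoot h₁) (X 3 ^ 2)) = 0 := by
  subst hh₂
  have h := AdjoinRoot.eval₂_root (Polynomial.X ^ 2 + (Polynomial.C (algebraMap (MvPolynomial (Fin 4) k) (AdjoinRoot h₁) (X 0)) * Polynomial.X +
      Polynomial.C (algebraMap (MvPolynomial (Fin 4) k) (AdjoinRoot h₁) (X 0 * (X 1 ^ 3 + X 2 ^ 3)) +
        AdjoinRoot.root h₁ * algebraMap (MvPolynomial (Fin 4) k) (AdjoinRoot h₁) (X 3 ^ 2))))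
  simp only [Polynomial.eval₂_add, Polynomial.eval₂_mul, Polynomial.eval₂_X_pow, Polynomial.eval₂_C, Polynomial.eval₂_X] at h
  linear_combination h

/-- Normal form in a monic extension of degree `≤ 2`: every element of `AdjoinRoot g` is `a + b·root`. [folklore] -/
theorem exists_nf_of_monic_two {R : Type} [CommRing R] {g : Polynomial R} (hg : g.Monic) (hdeg : g.natDegree ≤ 2)
    (e : AdjoinRoot g) : ∃ a b : R, e = AdjoinRoot.of g a + AdjoinRoot.of g b * AdjoinRoot.root g := by
  by_cases hg1 : g = 1
  · subst hg1
    haveI : Subsingleton (AdjoinRoot (1 : Polynomial R)) :=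
      Ideal.Quotient.subsingleton_iff.mpr (Ideal.span_singleton_one)
    exact ⟨0, 0, Subsingleton.elim _ _⟩
  obtain ⟨f, rfl⟩ := AdjoinRoot.mk_surjective e
  have hmod : AdjoinRoot.mk g (f %ₘ g) = AdjoinRoot.mk g f := by
    rw [Polynomial.modByMonic_eq_sub_mul_div f g, map_sub, map_mul, AdjoinRoot.mk_self, zero_mul, sub_zero]
  have hdegp : (f %ₘ g).natDegree ≤ 1 := by
    have h1 := Polynomial.natDegree_modByMonic_lt f hg hg1
    omega
  have hp := Polynomial.eq_X_add_C_of_natDegree_le_one hdegp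
  refine ⟨(f %ₘ g).coeff 0, (f %ₘ g).coeff 1, ?_⟩
  rw [← hmod]
  conv_lhs => rw [hp]
  simp only [map_add, map_mul, AdjoinRoot.mk_C, AdjoinRoot.mk_X]
  ring

/-- `natDegree h₁ ≤ 2`. [plumbing] -/
theorem natDegree_h₁_le (h₁ : Polynomial (MvPolynomial (Fin 4) k)) (hh₁ : h₁ = Polynomial.X ^ 2 - Polynomial.C (X 0 * X 3)) : h₁.natDegree ≤ 2 := by
  rw [hh₁]
  refine (Polynomial.natDegree_sub_le _ _).trans (max_le (Polynomial.natDegree_X_pow_le 2) ?_)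
  rw [Polynomial.natDegree_C]; exact Nat.zero_le _

/-- `natDegree h₂ ≤ 2`. [plumbing] -/
theorem natDegree_h₂_le (h₁ : Polynomial (MvPolynomial (Fin 4) k)) (h₂ : Polynomial (AdjoinRoot h₁))
    (hh₂ : h₂ = Polynomial.X ^ 2 + (Polynomial.C (algebraMap (MvPolynomial (Fin 4) k) (AdjoinRoot h₁) (X 0)) * Polynomial.X +
      Polynomial.C (algebraMap (MvPolynomial (Fin 4) k) (AdjoinRoot h₁) (X 0 * (X 1 ^ 3 + X 2 ^ 3)) +
        AdjoinRoot.root h₁ * algebraMap (MvPolynomial (Fin 4) k) (AdjoinRoot h₁) (X 3 ^ 2)))) : h₂.natDegree ≤ 2 := by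
  rw [hh₂]
  refine (Polynomial.natDegree_add_le _ _).trans (max_le (Polynomial.natDegree_X_pow_le 2) ?_)
  refine (Polynomial.natDegree_add_le _ _).trans (max_le ((Polynomial.natDegree_C_mul_le _ _).trans (Polynomial.natDegree_X_le.trans one_le_two)) ?_)
  rw [Polynomial.natDegree_C]; exact Nat.zero_le _

/-- `algebraMap B₀ T₂ = of h₂ ∘ algebraMap B₀ T₁`. [plumbing] -/
theorem algebraMap_tower_apply' (h₁ : Polynomial (MvPolynomial (Fin 4) k)) (h₂ : Polynomial (AdjoinRoot h₁)) (b : MvPolynomial (Fin 4) k) :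
    algebraMap (MvPolynomial (Fin 4) k) (AdjoinRoot h₂) b = AdjoinRoot.of h₂ (algebraMap (MvPolynomial (Fin 4) k) (AdjoinRoot h₁) b) := by
  rw [IsScalarTower.algebraMap_apply (MvPolynomial (Fin 4) k) (AdjoinRoot h₁) (AdjoinRoot h₂), AdjoinRoot.algebraMap_eq]

/-- `algebraMap B₀ T₂ = of h₂ ∘ of h₁`. [plumbing] -/
theorem algebraMap_tower_apply (h₁ : Polynomial (MvPolynomial (Fin 4) k)) (h₂ : Polynomial (AdjoinRoot h₁)) (b : MvPolynomial (Fin 4) k) :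
    algebraMap (MvPolynomial (Fin 4) k) (AdjoinRoot h₂) b = AdjoinRoot.of h₂ (AdjoinRoot.of h₁ b) := by
  rw [algebraMap_tower_apply', AdjoinRoot.algebraMap_eq]

/-- `t̄² = x̄·w̄` in `T₂`. [plumbing] -/
theorem t_sq_eq (h₁ : Polynomial (MvPolynomial (Fin 4) k)) (hh₁ : h₁ = Polynomial.X ^ 2 - Polynomial.C (X 0 * X 3)) (h₂ : Polynomial (AdjoinRoot h₁)) :
    AdjoinRoot.of h₂ (AdjoinRoot.root h₁) ^ 2 = algebraMap (MvPolynomial (Fin 4) k) (AdjoinRoot h₂) (X 0) * algebraMap (MvPolynomial (Fin 4) k) (AdjoinRoot h₂) (X 3) := by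
  rw [← map_pow, root₁_sq k h₁ hh₁, map_mul, map_mul, ← algebraMap_tower_apply, ← algebraMap_tower_apply]

/-- `z̄′² = −(x̄ z̄′ + x̄(ȳ′³+ū′³) + t̄ w̄²)` in `T₂`. [plumbing] -/
theorem z_sq_eq (h₁ : Polynomial (MvPolynomial (Fin 4) k)) (h₂ : Polynomial (AdjoinRoot h₁))
    (hh₂ : h₂ = Polynomial.X ^ 2 + (Polynomial.C (algebraMap (MvPolynomial (Fin 4) k) (AdjoinRoot h₁) (X 0)) * Polynomial.X +
      Polynomial.C (algebraMap (MvPolynomial (Fin 4) k) (AdjoinRoot h₁) (X 0 * (X 1 ^ 3 + X 2 ^ 3)) +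
        AdjoinRoot.root h₁ * algebraMap (MvPolynomial (Fin 4) k) (AdjoinRoot h₁) (X 3 ^ 2)))) :
    AdjoinRoot.root h₂ ^ 2 = -(algebraMap (MvPolynomial (Fin 4) k) (AdjoinRoot h₂) (X 0) * AdjoinRoot.root h₂ + algebraMap (MvPolynomial (Fin 4) k) (AdjoinRoot h₂) (X 0) * (algebraMap (MvPolynomial (Fin 4) k) (AdjoinRoot h₂) (X 1) ^ 3 + algebraMap (MvPolynomial (Fin 4) k) (AdjoinRoot h₂) (X 2) ^ 3) +
      AdjoinRoot.of h₂ (AdjoinRoot.root h₁) * algebraMap (MvPolynomial (Fin 4) k) (AdjoinRoot h₂) (X 3) ^ 2) := by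
  have h := root₂_rel k h₁ h₂ hh₂
  simp only [map_add, map_mul, map_pow, ← algebraMap_tower_apply'] at h
  linear_combination h

/-- ★ `x̄` is a NON-ZERO-DIVISOR of `T₂` (`T₂` is free, hence flat, over the domain `B₀`). [folklore] -/
theorem algebraMap_X0_mem_nonZeroDivisors (h₁ : Polynomial (MvPolynomial (Fin 4) k)) (hh₁ : h₁ = Polynomial.X ^ 2 - Polynomial.C (X 0 * X 3))
    (h₂ : Polynomial (AdjoinRoot h₁))
    (hh₂ : h₂ = Polynomial.X ^ 2 + (Polynomial.C (algebraMap (MvPolynomial (Fin 4) k) (AdjoinRoot h₁) (X 0)) * Polynomial.X +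
      Polynomial.C (algebraMap (MvPolynomial (Fin 4) k) (AdjoinRoot h₁) (X 0 * (X 1 ^ 3 + X 2 ^ 3)) +
        AdjoinRoot.root h₁ * algebraMap (MvPolynomial (Fin 4) k) (AdjoinRoot h₁) (X 3 ^ 2)))) :
    algebraMap (MvPolynomial (Fin 4) k) (AdjoinRoot h₂) (X 0) ∈ nonZeroDivisors (AdjoinRoot h₂) := by
  obtain ⟨hfree, -⟩ := free_finite_tower k h₁ hh₁ h₂ hh₂
  exact FlatIntegralCM.mem_nonZeroDivisors_algebraMap_of_flat_of_ne_zero (X_ne_zero 0)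

/-! ## §2 The universal property of the tower, extensionality, and the kill map `κ` -/

/-- ★ **UNIVERSAL PROPERTY OF `T₂`** (existence): a ring map `g : B₀ → S` and `t₀, z₀ ∈ S` satisfying the two tower relations extend to `κ : T₂ → S`
with `κ|B₀ = g`, `κ(t̄) = t₀`, `κ(z̄′) = z₀`. [folklore: `AdjoinRoot.lift` twice] -/
theorem exists_towerLift {S : Type} [CommRing S] (h₁ : Polynomial (MvPolynomial (Fin 4) k)) (hh₁ : h₁ = Polynomial.X ^ 2 - Polynomial.C (X 0 * X 3))
    (h₂ : Polynomial (AdjoinRoot h₁))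
    (hh₂ : h₂ = Polynomial.X ^ 2 + (Polynomial.C (algebraMap (MvPolynomial (Fin 4) k) (AdjoinRoot h₁) (X 0)) * Polynomial.X +
      Polynomial.C (algebraMap (MvPolynomial (Fin 4) k) (AdjoinRoot h₁) (X 0 * (X 1 ^ 3 + X 2 ^ 3)) +
        AdjoinRoot.root h₁ * algebraMap (MvPolynomial (Fin 4) k) (AdjoinRoot h₁) (X 3 ^ 2))))
    (g : MvPolynomial (Fin 4) k →+* S) (t₀ z₀ : S) (ht : t₀ ^ 2 = g (X 0) * g (X 3))
    (hz : z₀ ^ 2 + g (X 0) * z₀ + (g (X 0) * (g (X 1) ^ 3 + g (X 2) ^ 3) + t₀ * g (X 3) ^ 2) = 0) :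
    ∃ κ : AdjoinRoot h₂ →+* S, κ.comp (algebraMap (MvPolynomial (Fin 4) k) (AdjoinRoot h₂)) = g ∧
      κ (AdjoinRoot.of h₂ (AdjoinRoot.root h₁)) = t₀ ∧ κ (AdjoinRoot.root h₂) = z₀ := by
  have e1 : Polynomial.eval₂ g t₀ h₁ = 0 := by
    rw [hh₁, Polynomial.eval₂_sub, Polynomial.eval₂_X_pow, Polynomial.eval₂_C, map_mul, ht, sub_self]
  have hκ₁of : ∀ b, AdjoinRoot.lift g t₀ e1 (AdjoinRoot.of h₁ b) = g b := fun b => AdjoinRoot.lift_of e1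
  have hκ₁root : AdjoinRoot.lift g t₀ e1 (AdjoinRoot.root h₁) = t₀ := AdjoinRoot.lift_root e1
  have e2 : Polynomial.eval₂ (AdjoinRoot.lift g t₀ e1) z₀ h₂ = 0 := by
    rw [hh₂]
    simp only [Polynomial.eval₂_add, Polynomial.eval₂_mul, Polynomial.eval₂_pow, Polynomial.eval₂_C, Polynomial.eval₂_X,
      AdjoinRoot.algebraMap_eq, map_add, map_mul, map_pow, hκ₁of, hκ₁root]
    linear_combination hz
  refine ⟨AdjoinRoot.lift _ z₀ e2, RingHom.ext fun b => ?_, ?_, AdjoinRoot.lift_root e2⟩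
  · rw [RingHom.comp_apply, algebraMap_tower_apply, AdjoinRoot.lift_of e2, hκ₁of]
  · rw [AdjoinRoot.lift_of e2, hκ₁root]

/-- **Extensionality out of `T₂`**: two ring maps `T₂ → S` agreeing on `B₀`, on `t̄` and on `z̄′` are equal. [folklore] -/
theorem tower₂_ringHom_ext {S : Type} [CommRing S] (h₁ : Polynomial (MvPolynomial (Fin 4) k)) (h₂ : Polynomial (AdjoinRoot h₁))
    {φ ψ : AdjoinRoot h₂ →+* S} (hB : φ.comp (algebraMap (MvPolynomial (Fin 4) k) (AdjoinRoot h₂)) = ψ.comp (algebraMap (MvPolynomial (Fin 4) k) (AdjoinRoot h₂)))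
    (ht : φ (AdjoinRoot.of h₂ (AdjoinRoot.root h₁)) = ψ (AdjoinRoot.of h₂ (AdjoinRoot.root h₁))) (hz : φ (AdjoinRoot.root h₂) = ψ (AdjoinRoot.root h₂)) :
    φ = ψ := by
  refine TauFloorF5YChartAlgebra.adjoinRoot_ringHom_ext (fun r => ?_) hz
  have h1 : φ.comp (AdjoinRoot.of h₂) = ψ.comp (AdjoinRoot.of h₂) := by
    refine TauFloorF5YChartAlgebra.adjoinRoot_ringHom_ext (fun b => ?_) ht
    have := RingHom.congr_fun hB b
    simp only [RingHom.comp_apply, algebraMap_tower_apply] at this ⊢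
    exact this
  exact RingHom.congr_fun h1 r

/-- The substitution `x, w ↦ 0` on `B₀ = k[x, y′, u′, w]`, on variables. [plumbing] -/
theorem killXW_X (j : Fin 4) :
    aeval (fun i : Fin 4 => if i = 0 ∨ i = 3 then (0 : MvPolynomial (Fin 4) k) else X i) (X j : MvPolynomial (Fin 4) k) = if j = 0 ∨ j = 3 then 0 else X j := by
  rw [aeval_X]

/-- `q − q(x ↦ 0, w ↦ 0) ∈ (x, w)` for every `q ∈ B₀`. [folklore] -/
theorem sub_killXW_mem (q : MvPolynomial (Fin 4) k) :
    q - aeval (fun i : Fin 4 => if i = 0 ∨ i = 3 then (0 : MvPolynomial (Fin 4) k) else X i) q ∈ Ideal.span ({X 0, X 3} : Set (MvPolynomial (Fin 4) k)) := by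
  induction q using MvPolynomial.induction_on with
  | C a => rw [MvPolynomial.algHom_C]; simp
  | add p q hp hq =>
    rw [map_add, show p + q - (aeval _ p + aeval _ q) = (p - aeval _ p) + (q - aeval _ q) by ring]
    exact Ideal.add_mem _ hp hq
  | mul_X p i hp =>
    rw [map_mul, killXW_X]
    by_cases hi : i = 0 ∨ i = 3
    · rw [if_pos hi, mul_zero, sub_zero]
      refine Ideal.mul_mem_left _ _ (Ideal.subset_span ?_)
      rcases hi with rfl | rfl
      · exact Or.inl rfl
      · exact Or.inr rfl
    · rw [if_neg hi, show p * X i - aeval _ p * X i = (p - aeval _ p) * X i by ring]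
      exact Ideal.mul_mem_right _ _ hp

/-- The kernel of `x, w ↦ 0` on `B₀` is `(x, w)`. [folklore] -/
theorem ker_killXW_eq :
    RingHom.ker (aeval (fun i : Fin 4 => if i = 0 ∨ i = 3 then (0 : MvPolynomial (Fin 4) k) else X i)).toRingHom = Ideal.span ({X 0, X 3} : Set (MvPolynomial (Fin 4) k)) := by
  apply le_antisymm
  · intro q hq
    rw [RingHom.mem_ker] at hq
    have h := sub_killXW_mem k q
    change q - (aeval _).toRingHom q ∈ _ at h
    rwa [hq, sub_zero] at h
  · rw [Ideal.span_le]
    rintro q hq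
    rw [SetLike.mem_coe, RingHom.mem_ker]
    rcases hq with rfl | rfl
    · change aeval _ (X 0) = 0
      rw [killXW_X]; simp
    · change aeval _ (X 3) = 0
      rw [killXW_X]; simp

/-- `(x, w) ⊂ B₀ = k[x, y′, u′, w]` is prime. [folklore] -/
theorem isPrime_span_X0_X3 : (Ideal.span ({X 0, X 3} : Set (MvPolynomial (Fin 4) k))).IsPrime := by
  rw [← ker_killXW_eq]; exact RingHom.ker_isPrime _

/-- ★ `height (x, w) = 2` in `B₀ = k[x, y′, u′, w]`: `≤ 2` by Krull's height theorem (two generators), `≥ 2` by the chain `0 < (x) < (x, w)`.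
[cite: Matsumura1987, Thm. 13.5] -/
theorem height_span_X0_X3 : (Ideal.span ({X 0, X 3} : Set (MvPolynomial (Fin 4) k))).height = 2 := by
  classical
  haveI hP := isPrime_span_X0_X3 k
  apply le_antisymm
  · have hmin : Ideal.span ({X 0, X 3} : Set (MvPolynomial (Fin 4) k)) ∈
        (Ideal.span ((({X 0, X 3} : Finset (MvPolynomial (Fin 4) k)) : Set (MvPolynomial (Fin 4) k)))).minimalPrimes := by
      rw [Finset.coe_pair, Ideal.minimalPrimes_eq_subsingleton_self]; rfl
    refine (Ideal.height_le_card_of_mem_minimalPrimes_span_finset hmin).trans ?_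
    exact_mod_cast Finset.card_le_two
  · haveI h1 : (Ideal.span ({X 0} : Set (MvPolynomial (Fin 4) k))).IsPrime :=
      (Ideal.span_singleton_prime (X_ne_zero 0)).mpr MvPolynomial.X_prime
    have lt2 : Ideal.span ({X 0} : Set (MvPolynomial (Fin 4) k)) < Ideal.span {X 0, X 3} := by
      refine lt_of_le_of_ne (Ideal.span_mono (Set.singleton_subset_iff.mpr (Set.mem_insert _ _))) fun h => ?_
      have h3 : (X 3 : MvPolynomial (Fin 4) k) ∈ Ideal.span ({X 0} : Set (MvPolynomial (Fin 4) k)) :=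
        h ▸ Ideal.subset_span (Set.mem_insert_of_mem _ rfl)
      rw [Ideal.mem_span_singleton, MvPolynomial.X_dvd_X] at h3
      exact absurd h3 (by decide)
    have step1 : (1 : ℕ∞) ≤ (Ideal.span ({X 0} : Set (MvPolynomial (Fin 4) k))).height := by
      rw [Order.one_le_iff_ne_zero, Ne, Ideal.height_eq_zero_iff_eq_bot, Ideal.span_singleton_eq_bot]
      exact X_ne_zero 0
    have step2 := Ideal.height_add_one_le_of_lt_of_isPrime lt2
    calc (2 : ℕ∞) = 1 + 1 := by norm_num
      _ ≤ (Ideal.span ({X 0} : Set (MvPolynomial (Fin 4) k))).height + 1 := add_le_add step1 le_rfl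
      _ ≤ _ := step2

/-- ★ **THE KILL MAP `κ : T₂ → B₀`** (`x, w ↦ 0` on `B₀`, `t̄ ↦ 0`, `z̄′ ↦ 0`) exists: both tower relations die under `x, w, t, z′ ↦ 0`. [folklore] -/
theorem exists_killMap (h₁ : Polynomial (MvPolynomial (Fin 4) k)) (hh₁ : h₁ = Polynomial.X ^ 2 - Polynomial.C (X 0 * X 3))
    (h₂ : Polynomial (AdjoinRoot h₁))
    (hh₂ : h₂ = Polynomial.X ^ 2 + (Polynomial.C (algebraMap (MvPolynomial (Fin 4) k) (AdjoinRoot h₁) (X 0)) * Polynomial.X +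
      Polynomial.C (algebraMap (MvPolynomial (Fin 4) k) (AdjoinRoot h₁) (X 0 * (X 1 ^ 3 + X 2 ^ 3)) +
        AdjoinRoot.root h₁ * algebraMap (MvPolynomial (Fin 4) k) (AdjoinRoot h₁) (X 3 ^ 2)))) :
    ∃ κ : AdjoinRoot h₂ →+* MvPolynomial (Fin 4) k, κ.comp (algebraMap (MvPolynomial (Fin 4) k) (AdjoinRoot h₂)) = (aeval (fun i : Fin 4 => if i = 0 ∨ i = 3 then (0 : MvPolynomial (Fin 4) k) else X i)).toRingHom ∧
      κ (AdjoinRoot.of h₂ (AdjoinRoot.root h₁)) = 0 ∧ κ (AdjoinRoot.root h₂) = 0 :=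
  exists_towerLift k h₁ hh₁ h₂ hh₂ _ 0 0 (by simp) (by simp)

/-! ## §3 The CM clause at every prime of `T₂` -/

/-- ★ **CM AT EVERY PRIME OF `T₂`** — ONE `exact` over res-L1-w45a-stub-3's generic engine: `T₂` is Noetherian, free (⇒ flat) and finite (⇒ integral) over the
REGULAR ring `B₀ = k[x, y′, u′, w]`. [cite: Matsumura1987, Thm. 17.8, Thm. 23.3 (context)] -/
theorem cmCl_localization (h₁ : Polynomial (MvPolynomial (Fin 4) k)) (hh₁ : h₁ = Polynomial.X ^ 2 - Polynomial.C (X 0 * X 3))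
    (h₂ : Polynomial (AdjoinRoot h₁))
    (hh₂ : h₂ = Polynomial.X ^ 2 + (Polynomial.C (algebraMap (MvPolynomial (Fin 4) k) (AdjoinRoot h₁) (X 0)) * Polynomial.X +
      Polynomial.C (algebraMap (MvPolynomial (Fin 4) k) (AdjoinRoot h₁) (X 0 * (X 1 ^ 3 + X 2 ^ 3)) +
        AdjoinRoot.root h₁ * algebraMap (MvPolynomial (Fin 4) k) (AdjoinRoot h₁) (X 3 ^ 2))))
    (Q : Ideal (AdjoinRoot h₂)) [Q.IsPrime] : CMCl (Localization.AtPrime Q) := by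
  obtain ⟨hfree, hfin⟩ := free_finite_tower k h₁ hh₁ h₂ hh₂
  haveI : Algebra.IsIntegral (MvPolynomial (Fin 4) k) (AdjoinRoot h₂) := Algebra.IsIntegral.of_finite _ _
  exact FlatIntegralCM.cmCl_localization_of_isRegularRing (A := MvPolynomial (Fin 4) k) Q

/-- Stalk form: the CM clause holds at EVERY point of `Spec T₂`. [folklore transport] -/
theorem cmCl_stalk (h₁ : Polynomial (MvPolynomial (Fin 4) k)) (hh₁ : h₁ = Polynomial.X ^ 2 - Polynomial.C (X 0 * X 3))
    (h₂ : Polynomial (AdjoinRoot h₁))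
    (hh₂ : h₂ = Polynomial.X ^ 2 + (Polynomial.C (algebraMap (MvPolynomial (Fin 4) k) (AdjoinRoot h₁) (X 0)) * Polynomial.X +
      Polynomial.C (algebraMap (MvPolynomial (Fin 4) k) (AdjoinRoot h₁) (X 0 * (X 1 ^ 3 + X 2 ^ 3)) +
        AdjoinRoot.root h₁ * algebraMap (MvPolynomial (Fin 4) k) (AdjoinRoot h₁) (X 3 ^ 2))))
    (w : AlgebraicGeometry.Spec (.of (AdjoinRoot h₂))) : CMCl ((AlgebraicGeometry.Spec (.of (AdjoinRoot h₂))).presheaf.stalk w) := by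
  obtain ⟨hfree, hfin⟩ := free_finite_tower k h₁ hh₁ h₂ hh₂
  haveI : Algebra.IsIntegral (MvPolynomial (Fin 4) k) (AdjoinRoot h₂) := Algebra.IsIntegral.of_finite _ _
  exact FlatIntegralCM.cmCl_stalk_Spec_of_isRegularRing (A := MvPolynomial (Fin 4) k) w

end Summit.ResolutionOfSingularities.ResolutionOfSingularities.Theorems.FInjectiveMacaulayfication.TauFloorBXChartAlgebra

end
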